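import Mathlib
import Literature.Analysis.FluidPDE.ClassicalSolution
import Literature.Analysis.FluidPDE.LerayHopf
import Literature.Analysis.FluidPDE.NSWave0
import Summits.NavierStokesRegularity.NavierStokesRegularity.Theses.L3TimeExponentPincer
import Summits.NavierStokesRegularity.NavierStokesRegularity.Theorems.L3TimeExponentPincerJawEnergyFloor
import Summits.NavierStokesRegularity.NavierStokesRegularity.Theorems.L3TimeExponentPincerEffNode
import Summits.NavierStokesRegularity.NavierStokesRegularity.Theorems.L3TimeExponentPincerSmoothBranch
import Summits.NavierStokesRegularity.NavierStokesRegularity.Theorems.L3TimeExponentPincerSupercriticalSerrinL3StubFloorToDivergence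
import Summits.NavierStokesRegularity.NavierStokesRegularity.Theorems.L3TimeExponentPincerFullMorreyMostTimes
import Literature.Analysis.FunctionSpaces.WeakLimitLpBounds
import HarnessLib

/-!
# Exponent calculus of crux `L3CascadeJaw` (stmt-NavierStokesRegularity-19499) and its pointwise bracket

Support file for the PARENT crux `L3CascadeJaw` of route `L3TimeExponentPincer` (cell ns-regularity-ideate,
seat ns-pincer-19499-p1).  The crux: for every `q ∈ (4,5)` every frame solution (classical on `[0,T)`,
Leray–Hopf from a rapidly decaying datum) has `∫_{T₂}^T ‖u(t)‖_{L³}^q dt < ∞` on a final window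
("the clause at `q`").  This file records, kernel-checked and BY NAME, the elementary structure of the
clause as a function of the exponent and the POINTWISE statements that bracket the crux:

§1 exponent calculus (all unconditional):
* `lintegral_l3_rpow_lt_top_of_le`, `jawClause_anti` — the clause is ANTITONE in `q ≥ 0` on a final
  window (`x^{q'} ≤ 1 + x^q`, the tree's `ENNReal.rpow_le_one_add_rpow_of_le`, finite window);
* `jawClause_of_le_four` — the clause holds for EVERY `0 ≤ q ≤ 4` (energy floor `l3Jaw_four`, p425265);
* `l3CascadeJaw_iff_forall_lt_five` — `L3CascadeJaw ↔` the clause for every `q ∈ [0,5)`: the crux is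
  exactly "the integrability exponent of `t ↦ ‖u(t)‖₃` at `T` is `≥ 5`";
* `l3CascadeJaw_of_cofinal`, `l3CascadeJaw_iff_nat` — it suffices to prove the clause along ANY set of
  exponents cofinal in `5⁻` (e.g. `qₙ = 5 - 1/(n+2)`).

§2 the pointwise bracket (where the crux sits between two rate statements on the critical norm):
* `l3CascadeJaw_of_l3RateFifth` / `…_blowup` — UPPER: the Euler-speed `L³` RATE LAW
  "`‖u(t)‖₃ ≤ K (T-t)^{-1/5}` on a final window" for every frame solution (resp. every frame blow-up —
  exactly the conclusion shape of `l3RateLaw_of_effSatBlowup`, p420059) implies `L3CascadeJaw`; so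
  `EffSatBlowup ⇒ (L³ rate law on blow-ups) ⇒ L3CascadeJaw`, the middle node being formally weaker than the
  child crux;
* `exists_late_lt_rate_of_l3CascadeJaw` — LOWER: `L3CascadeJaw` implies that every frame solution is
  SEQUENTIALLY slower than every rate above `1/5`: for `θ₀ > 1/5`, `c > 0`, `T₁ < T` there is
  `t ∈ (T₁,T)` with `‖u(t)‖₃ < c (T-t)^{-θ₀}` (no `L³` floor above the Euler exponent; the contrapositive of
  the residual's registered `stub_floorToDivergence`, p417717);
* `exists_superEuler_blowup_of_not_l3CascadeJaw` — the KILL shape: `¬ L3CascadeJaw` forces a frame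
  blow-up whose `L³` norm beats every envelope `K (T-t)^{-1/5}` at times arbitrarily close to `T`.

§3 the unconditional energy-level portrait (the bracket's known floor, exponent `1/4` instead of `1/5`):
* `exists_late_lt_quarterRate` — EVERY frame solution has, for every `c > 0`, late times with
  `‖u(t)‖₃ < c (T-t)^{-1/4}` (`liminf_{t→T} (T-t)^{1/4}‖u(t)‖₃ = 0`; from `∫₀ᵀ‖u‖₃⁴ < ∞`, p425265, and
  `∫ dt/(T-t) = ∞`) — against Seregin's `‖u(t)‖₃ → ∞` at a blow-up (p429062);
* `quarterFast_density_zero` — the set of times where `‖u(t)‖₃ > ε (T-t)^{-1/4}` has DENSITY ZERO at `T`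
  for every `ε > 0` (log-integrability of its indicator, p441596's density lemma).

Numbers: known floor `1/4` (sequential and in density, unconditional) · crux = time-averaged `1/5`
(`L^q`, all `q < 5`) · sufficient pointwise `1/5` (limsup) · necessary pointwise `1/5 + 0` (liminf).

WHAT THIS IS NOT: not a claim about Navier–Stokes regularity or blow-up and no progress on the crux's open
content (Morrey-Type-II blow-ups); bookkeeping and portrait theorems landed `--supports … --as helper`.
-/

noncomputable section

namespace Summit.NavierStokesRegularity.NavierStokesRegularity.Theorems.L3TimeExponentPincerJawExponentCalculus

open MeasureTheory Set Function Filter Topology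
open scoped ENNReal NNReal
open Literature.Analysis.FluidPDE
open Summit.NavierStokesRegularity.NavierStokesRegularity.Theses.L3TimeExponentPincer (L3CascadeJaw)
open Summit.NavierStokesRegularity.NavierStokesRegularity.Theorems.L3TimeExponentPincerJawEnergyFloor
  (lintegral_eLpNorm_three_rpow_four_lt_top l3Jaw_four)
open Summit.NavierStokesRegularity.NavierStokesRegularity.Theorems.L3TimeExponentPincerEffNode
  (l3Hypothesis_of_rate)
open Summit.NavierStokesRegularity.NavierStokesRegularity.Theorems.L3TimeExponentPincerSmoothBranch
  (eLpNorm_three_bounded_of_hasSmoothExtensionPast)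
open Summit.NavierStokesRegularity.NavierStokesRegularity.Cruxes.SupercriticalSerrinL3.RateFloor
  (stub_floorToDivergence)
open Summit.NavierStokesRegularity.NavierStokesRegularity.Theorems.L3TimeExponentPincerFullMorreyMostTimes
  (aemeasurable_l3cube_of_frame density_zero_of_lintegral_indicator_inv_sub_lt_top)

/-! ## §1  Exponent calculus of the clause -/

/-- **Window integrability of `‖u‖₃^q` passes to every smaller exponent**: if
`∫_{T₂}^T ‖u(t)‖₃^q dt < ∞` then `∫_{T₂}^T ‖u(t)‖₃^{q'} dt < ∞` for `0 ≤ q' ≤ q` (finite window: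
`x^{q'} ≤ 1 + x^q`). [folklore] -/
theorem lintegral_l3_rpow_lt_top_of_le {u : ℝ → EuclideanSpace ℝ (Fin 3) → EuclideanSpace ℝ (Fin 3)}
    {T₂ T q q' : ℝ} (hq' : 0 ≤ q') (hle : q' ≤ q)
    (h : (∫⁻ t in Ioo T₂ T, eLpNorm (u t) 3 volume ^ q) < ⊤) :
    (∫⁻ t in Ioo T₂ T, eLpNorm (u t) 3 volume ^ q') < ⊤ := by
  have h1 : (∫⁻ t in Ioo T₂ T, eLpNorm (u t) 3 volume ^ q') ≤
      ∫⁻ t in Ioo T₂ T, (1 + eLpNorm (u t) 3 volume ^ q) :=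
    lintegral_mono fun t => ENNReal.rpow_le_one_add_rpow_of_le _ hq' hle
  have h2 : (∫⁻ t in Ioo T₂ T, (1 + eLpNorm (u t) 3 volume ^ q)) =
      volume (Ioo T₂ T) + ∫⁻ t in Ioo T₂ T, eLpNorm (u t) 3 volume ^ q := by
    rw [lintegral_add_left measurable_const, setLIntegral_const, one_mul]
  refine lt_of_le_of_lt (h1.trans h2.le) ?_
  rw [Real.volume_Ioo]
  exact ENNReal.add_lt_top.2 ⟨ENNReal.ofReal_lt_top, h⟩

/-- **The clause is antitone in the exponent**: a final window with `∫ ‖u‖₃^q < ∞` is a final window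
with `∫ ‖u‖₃^{q'} < ∞` for every `0 ≤ q' ≤ q`. [folklore] -/
theorem jawClause_anti {u : ℝ → EuclideanSpace ℝ (Fin 3) → EuclideanSpace ℝ (Fin 3)} {T q q' : ℝ}
    (hq' : 0 ≤ q') (hle : q' ≤ q)
    (h : ∃ T₂ ∈ Ioo 0 T, (∫⁻ t in Ioo T₂ T, eLpNorm (u t) 3 volume ^ q) < ⊤) :
    ∃ T₂ ∈ Ioo 0 T, (∫⁻ t in Ioo T₂ T, eLpNorm (u t) 3 volume ^ q') < ⊤ := by
  obtain ⟨T₂, hT₂, hfin⟩ := h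
  exact ⟨T₂, hT₂, lintegral_l3_rpow_lt_top_of_le hq' hle hfin⟩

/-- **The clause holds unconditionally for every exponent `0 ≤ q ≤ 4`** (energy floor of the crux:
`∫₀ᵀ ‖u(t)‖₃⁴ dt < ∞` for every frame solution, `l3Jaw_four`, plus antitonicity).
[cite: RobinsonRodrigoSadowski2016, Lemma 3.5] -/
theorem jawClause_of_le_four (q : ℝ) (hq0 : 0 ≤ q) (hq4 : q ≤ 4) :
    ∀ (ν T : ℝ), 0 < ν → 0 < T →
      ∀ (u : ℝ → EuclideanSpace ℝ (Fin 3) → EuclideanSpace ℝ (Fin 3)) (p : ℝ → EuclideanSpace ℝ (Fin 3) → ℝ),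
        IsClassicalNSSolutionOn (Ico 0 T) ν 0 u p → IsLerayHopfOn T ν 0 (u 0) u →
        HasRapidSpatialDecay (u 0) →
        ∃ T₂ ∈ Ioo 0 T, (∫⁻ t in Ioo T₂ T, eLpNorm (u t) 3 volume ^ q) < ⊤ :=
  fun ν T hν hT u p hcl hLH hdec => jawClause_anti hq0 hq4 (l3Jaw_four ν T hν hT u p hcl hLH hdec)

/-- **`L3CascadeJaw` ↔ the clause for every exponent `q ∈ [0,5)`.**  The crux quantifies over
`4 < q < 5`; below `4` the clause is the unconditional energy floor, so the crux says exactly that the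
integrability exponent of `t ↦ ‖u(t)‖₃` at `T` is at least `5` for every frame solution. [folklore] -/
theorem l3CascadeJaw_iff_forall_lt_five :
    L3CascadeJaw ↔
      ∀ q : ℝ, 0 ≤ q → q < 5 → ∀ (ν T : ℝ), 0 < ν → 0 < T →
        ∀ (u : ℝ → EuclideanSpace ℝ (Fin 3) → EuclideanSpace ℝ (Fin 3)) (p : ℝ → EuclideanSpace ℝ (Fin 3) → ℝ),
          IsClassicalNSSolutionOn (Ico 0 T) ν 0 u p → IsLerayHopfOn T ν 0 (u 0) u →
          HasRapidSpatialDecay (u 0) →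
          ∃ T₂ ∈ Ioo 0 T, (∫⁻ t in Ioo T₂ T, eLpNorm (u t) 3 volume ^ q) < ⊤ := by
  constructor
  · intro hJ q hq0 hq5 ν T hν hT u p hcl hLH hdec
    rcases le_or_gt q 4 with hq4 | hq4
    · exact jawClause_of_le_four q hq0 hq4 ν T hν hT u p hcl hLH hdec
    · exact hJ q hq4 hq5 ν T hν hT u p hcl hLH hdec
  · intro h q hq4 hq5
    exact h q (by linarith) hq5

/-- **Cofinality**: if the clause holds (for all frame solutions) along a set of exponents cofinal in
`5⁻`, then `L3CascadeJaw` holds (antitonicity). [folklore] -/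
theorem l3CascadeJaw_of_cofinal
    (h : ∀ q₀ : ℝ, q₀ < 5 → ∃ q : ℝ, q₀ ≤ q ∧
      ∀ (ν T : ℝ), 0 < ν → 0 < T →
        ∀ (u : ℝ → EuclideanSpace ℝ (Fin 3) → EuclideanSpace ℝ (Fin 3)) (p : ℝ → EuclideanSpace ℝ (Fin 3) → ℝ),
          IsClassicalNSSolutionOn (Ico 0 T) ν 0 u p → IsLerayHopfOn T ν 0 (u 0) u →
          HasRapidSpatialDecay (u 0) →
          ∃ T₂ ∈ Ioo 0 T, (∫⁻ t in Ioo T₂ T, eLpNorm (u t) 3 volume ^ q) < ⊤) :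
    L3CascadeJaw := by
  intro q hq4 hq5 ν T hν hT u p hcl hLH hdec
  obtain ⟨q', hqq', hq'⟩ := h q hq5
  exact jawClause_anti (by linarith) hqq' (hq' ν T hν hT u p hcl hLH hdec)

/-- **`L3CascadeJaw` ↔ the clause along the sequence `qₙ = 5 - 1/(n+2)`** (`n : ℕ`; `q₀ = 9/2`,
`qₙ ↑ 5`): a countable family of exponents suffices. [folklore] -/
theorem l3CascadeJaw_iff_nat :
    L3CascadeJaw ↔
      ∀ n : ℕ, ∀ (ν T : ℝ), 0 < ν → 0 < T →
        ∀ (u : ℝ → EuclideanSpace ℝ (Fin 3) → EuclideanSpace ℝ (Fin 3)) (p : ℝ → EuclideanSpace ℝ (Fin 3) → ℝ),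
          IsClassicalNSSolutionOn (Ico 0 T) ν 0 u p → IsLerayHopfOn T ν 0 (u 0) u →
          HasRapidSpatialDecay (u 0) →
          ∃ T₂ ∈ Ioo 0 T, (∫⁻ t in Ioo T₂ T, eLpNorm (u t) 3 volume ^ (5 - 1 / ((n : ℝ) + 2))) < ⊤ := by
  constructor
  · intro hJ n
    have hn : (0 : ℝ) ≤ n := Nat.cast_nonneg n
    have h1 : 0 < 1 / ((n : ℝ) + 2) := by positivity
    have h2 : 1 / ((n : ℝ) + 2) < 1 := by
      rw [div_lt_one (by positivity)]; linarith
    exact hJ _ (by linarith) (by linarith)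
  · intro h
    refine l3CascadeJaw_of_cofinal fun q₀ hq₀ => ?_
    obtain ⟨n, hn⟩ := exists_nat_gt (1 / (5 - q₀))
    have h50 : 0 < 5 - q₀ := by linarith
    have hn2 : 1 / (5 - q₀) < (n : ℝ) + 2 := by linarith
    have hle : 1 / ((n : ℝ) + 2) ≤ 5 - q₀ := by
      rw [div_le_iff₀ (by positivity)]
      have := (div_lt_iff₀ h50).1 hn2
      linarith
    exact ⟨5 - 1 / ((n : ℝ) + 2), by linarith, h n⟩

/-! ## §2  The pointwise bracket of the crux -/

/-- **UPPER bracket: the Euler-speed `L³` rate law implies `L3CascadeJaw`.**  If every frame solution obeys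
`‖u(t)‖₃ ≤ K (T-t)^{-1/5}` on a final window `(T₁,T)`, `0 ≤ T₁`, then the clause holds for every
`q < 5` (`q/5 < 1`, `l3Hypothesis_of_rate`). [folklore] -/
theorem l3CascadeJaw_of_l3RateFifth
    (h : ∀ (ν T : ℝ), 0 < ν → 0 < T →
      ∀ (u : ℝ → EuclideanSpace ℝ (Fin 3) → EuclideanSpace ℝ (Fin 3)) (p : ℝ → EuclideanSpace ℝ (Fin 3) → ℝ),
        IsClassicalNSSolutionOn (Ico 0 T) ν 0 u p → IsLerayHopfOn T ν 0 (u 0) u →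
        HasRapidSpatialDecay (u 0) →
        ∃ K : ℝ, 0 ≤ K ∧ ∃ T₁ : ℝ, 0 ≤ T₁ ∧ T₁ < T ∧ ∀ t ∈ Ioo T₁ T,
          eLpNorm (u t) 3 volume ≤ ENNReal.ofReal (K * (T - t) ^ (-(1 / 5 : ℝ)))) :
    L3CascadeJaw := by
  intro q hq4 hq5 ν T hν hT u p hcl hLH hdec
  obtain ⟨K, hK, T₁, hT₁0, hT₁T, hrate⟩ := h ν T hν hT u p hcl hLH hdec
  refine ⟨(T₁ + T) / 2, ⟨by linarith, by linarith⟩, ?_⟩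
  refine l3Hypothesis_of_rate (θ := 1 / 5) (by linarith) (by linarith) (by nlinarith) hK ?_
  intro t ht
  exact hrate t ⟨by linarith [ht.1], ht.2⟩

/-- **UPPER bracket, blow-up branch**: it suffices that every frame solution WITHOUT smooth extension past
`T` obeys the Euler-speed `L³` rate law (verbatim the conclusion shape of `l3RateLaw_of_effSatBlowup`) —
on the smooth branch `‖u(t)‖₃` is bounded near `T` (`eLpNorm_three_bounded_of_hasSmoothExtensionPast`).
Hence `EffSatBlowup ⇒ (L³ rate law on blow-ups) ⇒ L3CascadeJaw`, the middle statement being a node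
formally weaker than the child crux. [folklore] -/
theorem l3CascadeJaw_of_l3RateFifth_blowup
    (h : ∀ (ν T : ℝ), 0 < ν → 0 < T →
      ∀ (u : ℝ → EuclideanSpace ℝ (Fin 3) → EuclideanSpace ℝ (Fin 3)) (p : ℝ → EuclideanSpace ℝ (Fin 3) → ℝ),
        IsClassicalNSSolutionOn (Ico 0 T) ν 0 u p → IsLerayHopfOn T ν 0 (u 0) u →
        HasRapidSpatialDecay (u 0) → ¬ HasSmoothExtensionPast ν 0 u T →
        ∃ K : ℝ, 0 ≤ K ∧ ∃ T₁ : ℝ, 0 ≤ T₁ ∧ T₁ < T ∧ ∀ t ∈ Ioo T₁ T,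
          eLpNorm (u t) 3 volume ≤ ENNReal.ofReal (K * (T - t) ^ (-(1 / 5 : ℝ)))) :
    L3CascadeJaw := by
  refine l3CascadeJaw_of_l3RateFifth fun ν T hν hT u p hcl hLH hdec => ?_
  by_cases hext : HasSmoothExtensionPast ν 0 u T
  · -- smooth branch: `‖u(t)‖₃³ ≤ M` on `[0, T)`, and `M^{1/3} ≤ (M^{1/3} T^{1/5}) (T-t)^{-1/5}`
    obtain ⟨M, hM0, hM⟩ := eLpNorm_three_bounded_of_hasSmoothExtensionPast hν hT hLH hdec hext
    refine ⟨M ^ (1 / 3 : ℝ) * T ^ (1 / 5 : ℝ), by positivity, 0, le_rfl, hT, fun t ht => ?_⟩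
    have hTt : 0 < T - t := by linarith [ht.2]
    have hTtT : T - t ≤ T := by linarith [ht.1]
    have h3 : eLpNorm (u t) 3 volume ≤ ENNReal.ofReal (M ^ (1 / 3 : ℝ)) := by
      have h := ENNReal.rpow_le_rpow (hM t ⟨ht.1.le, ht.2⟩) (show (0 : ℝ) ≤ 1 / 3 by norm_num)
      rw [← ENNReal.rpow_mul, show (3 : ℝ) * (1 / 3) = 1 by norm_num, ENNReal.rpow_one,
        ENNReal.ofReal_rpow_of_nonneg hM0 (by norm_num)] at h
      exact h
    refine h3.trans (ENNReal.ofReal_le_ofReal ?_)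
    have hB0 : 0 ≤ M ^ (1 / 3 : ℝ) := Real.rpow_nonneg hM0 _
    have h1 : (1 : ℝ) ≤ T ^ (1 / 5 : ℝ) * (T - t) ^ (-(1 / 5 : ℝ)) := by
      rw [Real.rpow_neg hTt.le, ← div_eq_mul_inv, le_div_iff₀ (Real.rpow_pos_of_pos hTt _), one_mul]
      exact Real.rpow_le_rpow hTt.le hTtT (by norm_num)
    calc M ^ (1 / 3 : ℝ) = M ^ (1 / 3 : ℝ) * 1 := (mul_one _).symm
      _ ≤ M ^ (1 / 3 : ℝ) * (T ^ (1 / 5 : ℝ) * (T - t) ^ (-(1 / 5 : ℝ))) :=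
          mul_le_mul_of_nonneg_left h1 hB0
      _ = M ^ (1 / 3 : ℝ) * T ^ (1 / 5 : ℝ) * (T - t) ^ (-(1 / 5 : ℝ)) := by ring
  · exact h ν T hν hT u p hcl hLH hdec hext

/-- **LOWER bracket: under `L3CascadeJaw` no frame solution has an `L³` floor above the Euler exponent.**
If `L3CascadeJaw` holds then for every frame solution, every `θ₀ > 1/5`, `c > 0` and `T₁ < T` there is a
time `t ∈ (T₁, T)` with `‖u(t)‖₃ < c (T-t)^{-θ₀}` — i.e. `liminf_{t→T} (T-t)^{θ₀} ‖u(t)‖₃ = 0`: every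
solution is SEQUENTIALLY slower than every rate above `1/5` (a floor `‖u(t)‖₃ ≥ c (T-t)^{-θ₀}` on a final
window would make `∫ ‖u‖₃^q = ∞` for `q ≥ 1/θ₀`, `q < 5`: `stub_floorToDivergence`). [folklore] -/
theorem exists_late_lt_rate_of_l3CascadeJaw (hJ : L3CascadeJaw) {ν T : ℝ} (hν : 0 < ν) (hT : 0 < T)
    {u : ℝ → EuclideanSpace ℝ (Fin 3) → EuclideanSpace ℝ (Fin 3)} {p : ℝ → EuclideanSpace ℝ (Fin 3) → ℝ}
    (hcl : IsClassicalNSSolutionOn (Ico 0 T) ν 0 u p) (hLH : IsLerayHopfOn T ν 0 (u 0) u)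
    (hdec : HasRapidSpatialDecay (u 0)) {θ₀ : ℝ} (hθ₀ : 1 / 5 < θ₀) {c : ℝ} (hc : 0 < c)
    {T₁ : ℝ} (hT₁T : T₁ < T) :
    ∃ t ∈ Ioo T₁ T, eLpNorm (u t) 3 volume < ENNReal.ofReal (c * (T - t) ^ (-θ₀)) := by
  by_contra hne
  push Not at hne
  have hθ₀pos : 0 < θ₀ := lt_trans (by norm_num) hθ₀
  -- the exponent `q = max (1/θ₀) (9/2) ∈ (4,5)` with `q θ₀ ≥ 1`
  set q : ℝ := max (1 / θ₀) (9 / 2) with hq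
  have hq4 : 4 < q := lt_of_lt_of_le (by norm_num) (le_max_right _ _)
  have hinv : 1 / θ₀ < 5 := by
    rw [div_lt_iff₀ hθ₀pos]; nlinarith
  have hq5 : q < 5 := max_lt hinv (by norm_num)
  have hqθ : 1 ≤ q * θ₀ := by
    have h1 : 1 / θ₀ ≤ q := le_max_left _ _
    have h2 : 1 / θ₀ * θ₀ = 1 := by field_simp
    nlinarith
  obtain ⟨T₂, hT₂, hfin⟩ := hJ q hq4 hq5 ν T hν hT u p hcl hLH hdec
  have htop := stub_floorToDivergence T θ₀ q c T₁ u hc (by linarith) hqθ hT₁T hne T₂ hT₂.2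
  exact (lt_irrefl _) (htop ▸ hfin)

/-- **KILL shape of the crux**: if `L3CascadeJaw` FAILS, there is a frame solution with no smooth extension
past its `T` whose critical norm beats every Euler-speed envelope arbitrarily late — for every `K ≥ 0` and
every `T₁ ∈ [0,T)` some `t ∈ (T₁,T)` has `‖u(t)‖₃ > K (T-t)^{-1/5}` (`limsup (T-t)^{1/5}‖u(t)‖₃ = ∞`);
contrapositive of `l3CascadeJaw_of_l3RateFifth_blowup`. [folklore] -/
theorem exists_superEuler_blowup_of_not_l3CascadeJaw (hJ : ¬ L3CascadeJaw) :
    ∃ (ν T : ℝ), 0 < ν ∧ 0 < T ∧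
      ∃ (u : ℝ → EuclideanSpace ℝ (Fin 3) → EuclideanSpace ℝ (Fin 3)) (p : ℝ → EuclideanSpace ℝ (Fin 3) → ℝ),
        IsClassicalNSSolutionOn (Ico 0 T) ν 0 u p ∧ IsLerayHopfOn T ν 0 (u 0) u ∧
        HasRapidSpatialDecay (u 0) ∧ ¬ HasSmoothExtensionPast ν 0 u T ∧
        ∀ K : ℝ, 0 ≤ K → ∀ T₁ : ℝ, 0 ≤ T₁ → T₁ < T →
          ∃ t ∈ Ioo T₁ T, ENNReal.ofReal (K * (T - t) ^ (-(1 / 5 : ℝ))) < eLpNorm (u t) 3 volume := by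
  by_contra hne
  push Not at hne
  refine hJ (l3CascadeJaw_of_l3RateFifth_blowup fun ν T hν hT u p hcl hLH hdec hmax => ?_)
  obtain ⟨K, hK, T₁, hT₁0, hT₁T, hle⟩ := hne ν T hν hT u p hcl hLH hdec hmax
  exact ⟨K, hK, T₁, hT₁0, hT₁T, hle⟩

/-! ## §3  The unconditional energy-level portrait: exponent `1/4` -/

/-- **Every frame solution is sequentially slower than `c (T-t)^{-1/4}` for every `c > 0`**: for
`ν, T > 0`, a classical solution on `[0,T)` that is Leray–Hopf from its datum, every `c > 0` and every
`T₁ < T`, some `t ∈ (max T₁ 0, T)` has `‖u(t)‖₃ < c (T-t)^{-1/4}`; i.e.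
`liminf_{t→T⁻} (T-t)^{1/4} ‖u(t)‖₃ = 0` UNCONDITIONALLY (a floor `c (T-t)^{-1/4}` on a final window would
give `∫ ‖u‖₃⁴ ≥ c⁴ ∫ dt/(T-t) = ∞`, against the energy-level bound `∫₀ᵀ ‖u(t)‖₃⁴ dt < ∞`).  The crux
`L3CascadeJaw` would improve `1/4` to every `θ₀ > 1/5` (`exists_late_lt_rate_of_l3CascadeJaw`).
[cite: RobinsonRodrigoSadowski2016, Lemma 3.5] -/
theorem exists_late_lt_quarterRate {ν T : ℝ} (hν : 0 < ν) (hT : 0 < T)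
    {u : ℝ → EuclideanSpace ℝ (Fin 3) → EuclideanSpace ℝ (Fin 3)} {p : ℝ → EuclideanSpace ℝ (Fin 3) → ℝ}
    (hcl : IsClassicalNSSolutionOn (Ico 0 T) ν 0 u p) (hLH : IsLerayHopfOn T ν 0 (u 0) u)
    {c : ℝ} (hc : 0 < c) {T₁ : ℝ} (hT₁T : T₁ < T) :
    ∃ t ∈ Ioo (max T₁ 0) T, eLpNorm (u t) 3 volume < ENNReal.ofReal (c * (T - t) ^ (-(1 / 4 : ℝ))) := by
  by_contra hne
  push Not at hne
  have hfin := lintegral_eLpNorm_three_rpow_four_lt_top hν hcl hLH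
  have htop := stub_floorToDivergence T (1 / 4) 4 c (max T₁ 0) u hc (by norm_num) (by norm_num)
    (max_lt hT₁T hT) hne 0 hT
  exact (lt_irrefl _) (htop ▸ hfin)

/-- `t ↦ ‖u(t)‖₃⁴` is a.e.-measurable on `(0,T)` for a classical solution on `[0,T)` (from the cube,
`aemeasurable_l3cube_of_frame`, by the continuous map `y ↦ y^{4/3}`). [folklore] -/
theorem aemeasurable_l3_rpow_four_of_frame {ν T : ℝ}
    {u : ℝ → EuclideanSpace ℝ (Fin 3) → EuclideanSpace ℝ (Fin 3)} {p : ℝ → EuclideanSpace ℝ (Fin 3) → ℝ}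
    (hcl : IsClassicalNSSolutionOn (Ico 0 T) ν 0 u p) :
    AEMeasurable (fun t => eLpNorm (u t) 3 volume ^ (4 : ℝ)) (volume.restrict (Ioo 0 T)) := by
  have h := (ENNReal.continuous_rpow_const (y := (4 / 3 : ℝ))).measurable.comp_aemeasurable
    (aemeasurable_l3cube_of_frame hcl)
  refine h.congr (Eventually.of_forall fun t => ?_)
  simp only [Function.comp]
  rw [← ENNReal.rpow_mul]
  norm_num

/-- **The quarter-rate fast set has DENSITY ZERO at `T`, unconditionally.**  For `ν, T > 0`, a classical
solution on `[0,T)` that is Leray–Hopf from its datum and every `ε > 0`: the set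
`F = {t : ε (T-t)^{-1/4} < ‖u(t)‖₃}` satisfies, for every `δ > 0`, `|F ∩ (T-h,T)| ≤ δ h` for all small
`h > 0` (on `F ∩ (0,T)`, `1/(T-t) < ε⁻⁴ ‖u(t)‖₃⁴`, so `∫_F dt/(T-t) ≤ ε⁻⁴ ∫₀ᵀ ‖u‖₃⁴ < ∞`, and a
log-integrable set has density zero, `density_zero_of_lintegral_indicator_inv_sub_lt_top`).  In words:
`(T-t)^{1/4}‖u(t)‖₃ → 0` in density at `T` for EVERY frame solution; the crux lives strictly below this
scale (`1/5 < 1/4`). [cite: RobinsonRodrigoSadowski2016, Lemma 3.5] -/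
theorem quarterFast_density_zero {ν T : ℝ} (hν : 0 < ν) (hT : 0 < T)
    {u : ℝ → EuclideanSpace ℝ (Fin 3) → EuclideanSpace ℝ (Fin 3)} {p : ℝ → EuclideanSpace ℝ (Fin 3) → ℝ}
    (hcl : IsClassicalNSSolutionOn (Ico 0 T) ν 0 u p) (hLH : IsLerayHopfOn T ν 0 (u 0) u)
    {ε : ℝ} (hε : 0 < ε) :
    ∀ δ : ℝ, 0 < δ → ∃ h₀ : ℝ, 0 < h₀ ∧ ∀ h : ℝ, 0 < h → h < h₀ →
      volume ({t | ENNReal.ofReal (ε * (T - t) ^ (-(1 / 4 : ℝ))) < eLpNorm (u t) 3 volume} ∩ Ioo (T - h) T)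
        ≤ ENNReal.ofReal (δ * h) := by
  set F : Set ℝ := {t | ENNReal.ofReal (ε * (T - t) ^ (-(1 / 4 : ℝ))) < eLpNorm (u t) 3 volume} with hF
  -- the fast set within `(0,T)` is the fast set for the fourth powers
  set F4 : Set ℝ := {t | ENNReal.ofReal (ε ^ 4 * (T - t) ^ (-(1 : ℝ))) < eLpNorm (u t) 3 volume ^ (4 : ℝ)}
    with hF4
  have hpow : ∀ t ∈ Ioo 0 T, (t ∈ F ↔ t ∈ F4) := by
    intro t ht
    have hTt : 0 < T - t := sub_pos.2 ht.2
    have hnn : 0 ≤ ε * (T - t) ^ (-(1 / 4 : ℝ)) := mul_nonneg hε.le (Real.rpow_nonneg hTt.le _)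
    have he : ENNReal.ofReal (ε * (T - t) ^ (-(1 / 4 : ℝ))) ^ (4 : ℝ) =
        ENNReal.ofReal (ε ^ 4 * (T - t) ^ (-(1 : ℝ))) := by
      rw [ENNReal.ofReal_rpow_of_nonneg hnn (by norm_num), Real.mul_rpow hε.le (Real.rpow_nonneg hTt.le _),
        ← Real.rpow_mul hTt.le]
      congr 2
      · rw [show (4 : ℝ) = ((4 : ℕ) : ℝ) by norm_num, Real.rpow_natCast]
      · norm_num
    simp only [hF, hF4, mem_setOf_eq]
    constructor
    · intro hlt
      rw [← he]
      exact ENNReal.rpow_lt_rpow hlt (by norm_num)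
    · intro hlt
      by_contra hge
      push Not at hge
      have := ENNReal.rpow_le_rpow hge (show (0 : ℝ) ≤ 4 by norm_num)
      rw [he] at this
      exact (lt_irrefl _) (lt_of_lt_of_le hlt this)
  -- null-measurability of `F` on `(0,T)` (through `F4`)
  have hmeas_thr : Measurable fun t : ℝ => ENNReal.ofReal (ε ^ 4 * (T - t) ^ (-(1 : ℝ))) :=
    (measurable_const.mul ((measurable_const.sub measurable_id).pow_const _)).ennreal_ofReal
  have hF4null : NullMeasurableSet F4 (volume.restrict (Ioo 0 T)) :=
    nullMeasurableSet_lt hmeas_thr.aemeasurable (aemeasurable_l3_rpow_four_of_frame hcl)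
  have hFF4 : F =ᵐ[volume.restrict (Ioo 0 T)] F4 := by
    refine (ae_restrict_mem measurableSet_Ioo).mono fun t ht => ?_
    exact propext (hpow t ht)
  have hFnull : NullMeasurableSet F (volume.restrict (Ioo 0 T)) := hF4null.congr hFF4.symm
  -- log-integrability of the indicator: `1_F (T-t)⁻¹ ≤ ε⁻⁴ ‖u(t)‖₃⁴` on `(0,T)`
  have hpt : ∀ t ∈ Ioo 0 T, F.indicator (fun t => ENNReal.ofReal ((T - t)⁻¹)) t ≤
      ENNReal.ofReal ((ε ^ 4)⁻¹) * eLpNorm (u t) 3 volume ^ (4 : ℝ) := by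
    intro t ht
    by_cases htF : t ∈ F
    · rw [indicator_of_mem htF]
      have ht4 : t ∈ F4 := (hpow t ht).1 htF
      have hTt : 0 < T - t := sub_pos.2 ht.2
      have hε4 : 0 < ε ^ 4 := by positivity
      have h1 : ENNReal.ofReal ((T - t)⁻¹) =
          ENNReal.ofReal ((ε ^ 4)⁻¹) * ENNReal.ofReal (ε ^ 4 * (T - t) ^ (-(1 : ℝ))) := by
        rw [← ENNReal.ofReal_mul (inv_nonneg.2 hε4.le), Real.rpow_neg hTt.le, Real.rpow_one]
        congr 1
        field_simp
      rw [h1]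
      exact mul_le_mul_of_nonneg_left (le_of_lt ht4) bot_le
    · rw [indicator_of_notMem htF]
      exact bot_le
  have hint : ∫⁻ t in Ioo 0 T, F.indicator (fun t => ENNReal.ofReal ((T - t)⁻¹)) t < ⊤ := by
    have h1 : (∫⁻ t in Ioo 0 T, F.indicator (fun t => ENNReal.ofReal ((T - t)⁻¹)) t) ≤
        ∫⁻ t in Ioo 0 T, ENNReal.ofReal ((ε ^ 4)⁻¹) * eLpNorm (u t) 3 volume ^ (4 : ℝ) :=
      lintegral_mono_ae ((ae_restrict_mem measurableSet_Ioo).mono fun t ht => hpt t ht)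
    refine lt_of_le_of_lt h1 ?_
    rw [lintegral_const_mul' _ _ ENNReal.ofReal_ne_top]
    exact ENNReal.mul_lt_top ENNReal.ofReal_lt_top (lintegral_eLpNorm_three_rpow_four_lt_top hν hcl hLH)
  exact density_zero_of_lintegral_indicator_inv_sub_lt_top hT hFnull hint

end Summit.NavierStokesRegularity.NavierStokesRegularity.Theorems.L3TimeExponentPincerJawExponentCalculus

end
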